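import Summits.ResolutionOfSingularities.ResolutionOfSingularities.Theorems.EquisingularLiftEquisingularLiftBlowupModelThree
import Summits.ResolutionOfSingularities.ResolutionOfSingularities.Theorems.ValuativePatchingRelBlowupSequenceComposite
import Literature.AlgebraicGeometry.Resolution.NuEliminationInDim
import Literature.AlgebraicGeometry.Resolution.SurfaceResolutionPermissibleCentres
import HarnessLib

/-!
# Crux `EquisingularLift` (stmt-ResolutionOfSingularities-15660), line `Sketch` (skeleton v10c `f3e6993bf39ec5c9`):
# the stub `stub_CJS2020Sequence` REDUCED to the tree's CJS-port trunk fact (`Σ^max`- / `ν`-eliminations in dimension `≤ 2`)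

[OURS · leafhand-res-equisingularlift-1 g1, 2026-08-31] AI-produced, weaker than expert review; NOT a statement of any
manuscript; nothing here proves resolution of singularities in positive characteristic.

The registered stub `stub_CJS2020Sequence : CossartJannsenSaito2020Sequence.{0}` asks for Cossart–Jannsen–Saito,
Introduction Thm. 1 (= Lipman 1978 in blow-up form): every reduced excellent Noetherian scheme of dimension `≤ 2` has a
resolution `π : X' → X` which is an isomorphism over `Reg X` AND is a finite sequence of blow-ups in centres lying in the
non-regular loci (`IsSingularBlowupSequence π`).  The tree already PROVES (files `SigmaMaxEliminationInDim.lean`,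
`NuEliminationInDim.lean`, `QuasiExcellentSchemesProofs.lean`):

* `resolutionSequenceInDim_of_sigmaMaxEliminationInDim d` — CJS Cor. 6.18 with the termination Thm. 6.17, EVERY `d`:
  `Σ^max`-eliminations in dimension `≤ d` give every reduced excellent Noetherian `X` of dimension `≤ d` a blow-up
  sequence `s : CentreSeq X` with centres over `X ∖ Reg X` and regular last scheme (`ResolutionSequenceInDim d`);
* `sigmaMaxEliminationInDim_of_nuEliminationInDim d` — the Def. 6.14 gluing of `ν`-eliminations;
* `exists_isResolution_of_centreSeq` — such an `s` composes to a resolution which is an isomorphism over `Reg X`.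

This file adds the one missing bookkeeping step and the resulting bridges:

* `isSingularBlowupSequence_comp_of_centresOver` — a blow-up sequence of a Noetherian scheme with centres over
  `X ∖ Reg X` composes to ONE blow-up along an ideal sheaf supported in `X ∖ Reg X` (Temkin 2008 Lemma 2.1.4 /
  Stacks 080B iterated, in tree as `Theorems.CentreSeq.exists_isBlowup_comp_of_centresOver`), hence its composite IS
  an `IsSingularBlowupSequence` (of length one, `IsSingularBlowupSequence.of_isBlowup`);
* `cossartJannsenSaito2020Sequence_of_resolutionSequenceInDim : ResolutionSequenceInDim 2 → CossartJannsenSaito2020Sequence`;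
* `cossartJannsenSaito2020Sequence_of_sigmaMaxElimination : CossartJannsenSaito2020_sigmaMaxElimination → CossartJannsenSaito2020Sequence`
  — the hypothesis is VERBATIM the registered stub `stub_cjsSigmaMaxElimination` of the crux `SigmaMaxModifications`
  (lines `Sketch` / `pointed_reduction` / `hs_curve_locus`), so the `n = 3` leaf of `EquisingularLift` now hangs on the
  SAME single named fact as the tree's weak form `CossartJannsenSaito2020General` (`…General_of_sigmaMaxElimination`);
* `cossartJannsenSaito2020Sequence_of_nuElimination` — from the `ν`-wise fact CJS Thm. 6.28 alone;
* `cossartJannsenSaito2020Sequence_of_sequencePermissible` (bookkeeping): the printed-permissible sibling also suffices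
  along this route (same conclusion as the tree's direct bridge `CossartJannsenSaito2020SequencePermissible.sequence`);
* `stub_CJS2020Sequence_of_sigmaMaxElimination`, `stub_blowupModel_three_of_sigmaMaxElimination`,
  `stub_blowupModel_three_of_nuElimination` — the registered stub and the `n = 3` regular-blow-up-model leaf of the line,
  CONDITIONAL on that single fact (after the one fact binder the types are the registered signatures verbatim).

Honest label: `stub_CJS2020Sequence` is NOT closed; its debt is reduced from "the CJS monograph as one named fact" to the
tree's existing port target `CossartJannsenSaito2020_sigmaMaxElimination` (CJS Thm. 6.28 + 3.10 (1), Chs. 7–14).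

References: [CossartJannsenSaito2020, Introduction Thm. 1; Thm. 1.2; Def. 6.14/6.15; Thm. 6.17; Cor. 6.18; Thm. 6.28];
[Temkin2008, Lemma 2.1.4]; [StacksProject, Tag 080B]; [Lipman1978, Theorem p. 151].
-/

set_option linter.dupNamespace false -- mandated namespace `Summit.<Summit>.<Problem>` of this single-conjunct summit

noncomputable section

open CategoryTheory AlgebraicGeometry TopologicalSpace
open Literature.AlgebraicGeometry.Resolution Literature.AlgebraicGeometry.Motives

universe u

namespace Summit.ResolutionOfSingularities.ResolutionOfSingularities.Cruxes.EquisingularLift.StrataSplit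

/-! ## A blow-up sequence with centres over the singular locus is a sequence of blow-ups in singular centres -/

/-- **A multiple blow-up of a Noetherian scheme whose centres lie over `X ∖ Reg X` composes to a (one-step)
sequence of blow-ups in singular centres**: by Temkin 2008 Lemma 2.1.4 / Stacks 080B iterated
(`Theorems.CentreSeq.exists_isBlowup_comp_of_centresOver`) the composite `s.comp : X_r → X` is ONE blow-up of `X`
along an ideal sheaf supported in `X ∖ Reg X`, which is an `IsSingularBlowupSequence` of length one.
[cite: Temkin2008, Lemma 2.1.4] [cite: StacksProject, Tag 080B] -/
theorem isSingularBlowupSequence_comp_of_centresOver {X : Scheme.{u}} [IsNoetherian X] (s : CentreSeq X)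
    (hs : s.CentresOver (Scheme.regularLocus X)ᶜ) : IsSingularBlowupSequence s.comp := by
  obtain ⟨Q, hQ, hQs⟩ :=
    Summit.ResolutionOfSingularities.ResolutionOfSingularities.Theorems.CentreSeq.exists_isBlowup_comp_of_centresOver
      s _ hs
  exact IsSingularBlowupSequence.of_isBlowup hQ hQs

/-! ## The bridges -/

/-- **CJS Introduction Thm. 1 in the tree's blow-up form (`CossartJannsenSaito2020Sequence`) from a resolution by a
blow-up sequence with centres over the singular locus in dimension `≤ 2` (`ResolutionSequenceInDim 2`, the conclusion
of Cor. 6.18).** The composite is a resolution which is an isomorphism over the open `Reg X`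
(`exists_isResolution_of_centreSeq`; `X` excellent hence quasi-excellent) and a one-step sequence of blow-ups in
singular centres (`isSingularBlowupSequence_comp_of_centresOver`).
[cite: CossartJannsenSaito2020, Thm. 1.2 and Cor. 6.18] -/
theorem cossartJannsenSaito2020Sequence_of_resolutionSequenceInDim (h : ResolutionSequenceInDim.{u} 2) :
    CossartJannsenSaito2020Sequence.{u} := by
  intro X _ _ hexc hdim
  obtain ⟨s, hs, hreg⟩ := h X hexc (by exact_mod_cast hdim)
  obtain ⟨hres, U, hU, hiso⟩ := exists_isResolution_of_centreSeq hexc.isQuasiExcellent s hs hreg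
  exact ⟨s.top, s.comp, hres, isSingularBlowupSequence_comp_of_centresOver s hs, U, hU, hiso⟩

/-- **`CossartJannsenSaito2020Sequence` from `Σ^max`-eliminations in dimension `≤ 2`** (the `ℕ`-indexed predicate
`SigmaMaxEliminationInDim 2`): Cor. 6.18 with Thm. 6.17 (`resolutionSequenceInDim_of_sigmaMaxEliminationInDim`, proved
in the tree) and the previous bridge. [cite: CossartJannsenSaito2020, Cor. 6.18, Thm. 6.17] -/
theorem cossartJannsenSaito2020Sequence_of_sigmaMaxEliminationInDim_two (h : SigmaMaxEliminationInDim.{u} 2) :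
    CossartJannsenSaito2020Sequence.{u} :=
  cossartJannsenSaito2020Sequence_of_resolutionSequenceInDim (resolutionSequenceInDim_of_sigmaMaxEliminationInDim 2 h)

/-- **`CossartJannsenSaito2020Sequence` from the tree's single named fact `CossartJannsenSaito2020_sigmaMaxElimination`**
(CJS Thm. 6.28 with Thm. 3.10 (1) and the gluing of Def. 6.14: `Σ^max`-eliminations exist in dimension `≤ 2`) — the
registered stub `stub_cjsSigmaMaxElimination` of the crux `SigmaMaxModifications`. With this bridge the Introduction
Thm. 1 form, the weak form `CossartJannsenSaito2020General` (`…General_of_sigmaMaxElimination`) and the `n = 3` leaf of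
`EquisingularLift` all hang on that one fact. [cite: CossartJannsenSaito2020, Thm. 6.28, Def. 6.15, Cor. 6.18] -/
theorem cossartJannsenSaito2020Sequence_of_sigmaMaxElimination (h : CossartJannsenSaito2020_sigmaMaxElimination.{u}) :
    CossartJannsenSaito2020Sequence.{u} :=
  cossartJannsenSaito2020Sequence_of_sigmaMaxEliminationInDim_two (sigmaMaxEliminationInDim_two_iff.mpr h)

/-- **`CossartJannsenSaito2020Sequence` from the `ν`-wise fact CJS Thm. 6.28 alone** (`CossartJannsenSaito2020_nuElimination`;
the Def. 6.14 gluing `…_sigmaMaxElimination_of_nuElimination` is proved in the tree).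
[cite: CossartJannsenSaito2020, Thm. 6.28, Def. 6.14] -/
theorem cossartJannsenSaito2020Sequence_of_nuElimination (h : CossartJannsenSaito2020_nuElimination.{u}) :
    CossartJannsenSaito2020Sequence.{u} :=
  cossartJannsenSaito2020Sequence_of_sigmaMaxElimination (CossartJannsenSaito2020_sigmaMaxElimination_of_nuElimination h)

/-- **`CossartJannsenSaito2020Sequence` from `ν`-eliminations in dimension `≤ 2`** (the `ℕ`-indexed predicate
`NuEliminationInDim 2`). [cite: CossartJannsenSaito2020, Thm. 6.28, Def. 6.14, Cor. 6.18] -/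
theorem cossartJannsenSaito2020Sequence_of_nuEliminationInDim_two (h : NuEliminationInDim.{u} 2) :
    CossartJannsenSaito2020Sequence.{u} :=
  cossartJannsenSaito2020Sequence_of_resolutionSequenceInDim (resolutionSequenceInDim_of_nuEliminationInDim 2 h)

/-- Bookkeeping: the printed-permissible sibling `CossartJannsenSaito2020SequencePermissible` (Thm. 1.2 with permissible
centres `D_i ⊆ (X_i)_sing`) also yields `ResolutionSequenceInDim 2` (in tree) and hence the fact along THIS route too —
the same conclusion as the tree's direct bridge `CossartJannsenSaito2020SequencePermissible.sequence`.
[cite: CossartJannsenSaito2020, Thm. 1.2] -/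
theorem cossartJannsenSaito2020Sequence_of_sequencePermissible (h : CossartJannsenSaito2020SequencePermissible.{u}) :
    CossartJannsenSaito2020Sequence.{u} :=
  cossartJannsenSaito2020Sequence_of_resolutionSequenceInDim h.resolutionSequenceInDim

/-! ## The registered stub and the `n = 3` leaf, conditional on the single trunk fact -/

/-- **Stub `stub_CJS2020Sequence` of skeleton v10c CONDITIONAL on `CossartJannsenSaito2020_sigmaMaxElimination`**
(after the fact binder the type is the registered signature `CossartJannsenSaito2020Sequence.{0}` verbatim). NOT a
close of the stub: the hypothesis is an unproved published theorem (CJS Thm. 6.28 + 3.10 (1)).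
[cite: CossartJannsenSaito2020, Introduction Thm. 1, Thm. 6.28] -/
theorem stub_CJS2020Sequence_of_sigmaMaxElimination (h : CossartJannsenSaito2020_sigmaMaxElimination.{0}) :
    Literature.AlgebraicGeometry.Resolution.CossartJannsenSaito2020Sequence.{0} :=
  cossartJannsenSaito2020Sequence_of_sigmaMaxElimination h

/-- **Stub `stub_CJS2020Sequence` CONDITIONAL on the `ν`-wise fact `CossartJannsenSaito2020_nuElimination`** (CJS
Thm. 6.28). [cite: CossartJannsenSaito2020, Introduction Thm. 1, Thm. 6.28] -/
theorem stub_CJS2020Sequence_of_nuElimination (h : CossartJannsenSaito2020_nuElimination.{0}) :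
    Literature.AlgebraicGeometry.Resolution.CossartJannsenSaito2020Sequence.{0} :=
  cossartJannsenSaito2020Sequence_of_nuElimination h

/-- **The `n = 3` leaf `stub_blowupModel_three` (regular projective blow-up models of integral surfaces in `ℙ³_k`)
CONDITIONAL on `CossartJannsenSaito2020_sigmaMaxElimination` alone**: `stub_blowupModel_three_of_CJS` (in tree, from
`CossartJannsenSaito2020Sequence`) composed with `cossartJannsenSaito2020Sequence_of_sigmaMaxElimination`; after the
fact binder the type is the registered `stub_blowupModel_three` signature verbatim.
[cite: CossartJannsenSaito2020, Thm. 6.28, Cor. 6.18] [cite: StacksProject, Tag 080B] -/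
theorem stub_blowupModel_three_of_sigmaMaxElimination (h : CossartJannsenSaito2020_sigmaMaxElimination.{0}) : ∀ p : ℕ, p.Prime → ∀ (k : Type) [Field k] [CharP k p] [IsAlgClosed k] (n : ℕ) (H : AlgebraicGeometry.Scheme.{0}) (ι : H ⟶ (Literature.AlgebraicGeometry.Motives.projectiveSpace n k).left), AlgebraicGeometry.IsClosedImmersion ι → AlgebraicGeometry.IsIntegral H → (∀ y : (Literature.AlgebraicGeometry.Motives.projectiveSpace n k).left, ∃ U : (Literature.AlgebraicGeometry.Motives.projectiveSpace n k).left.affineOpens, y ∈ (U : (Literature.AlgebraicGeometry.Motives.projectiveSpace n k).left.Opens) ∧ (ι.ker.ideal U).IsPrincipal) → n = 3 → ∃ 𝔞 : H.IdealSheafData, 𝔞 ≠ ⊥ ∧ ∀ (Z : AlgebraicGeometry.Scheme.{0}) (π : Z ⟶ H), Literature.AlgebraicGeometry.Resolution.IsBlowup π 𝔞 → Literature.AlgebraicGeometry.Resolution.Scheme.IsRegular Z :=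
  stub_blowupModel_three_of_CJS (cossartJannsenSaito2020Sequence_of_sigmaMaxElimination h)

/-- **The `n = 3` leaf CONDITIONAL on the `ν`-wise fact CJS Thm. 6.28** (`CossartJannsenSaito2020_nuElimination`).
[cite: CossartJannsenSaito2020, Thm. 6.28] [cite: StacksProject, Tag 080B] -/
theorem stub_blowupModel_three_of_nuElimination (h : CossartJannsenSaito2020_nuElimination.{0}) : ∀ p : ℕ, p.Prime → ∀ (k : Type) [Field k] [CharP k p] [IsAlgClosed k] (n : ℕ) (H : AlgebraicGeometry.Scheme.{0}) (ι : H ⟶ (Literature.AlgebraicGeometry.Motives.projectiveSpace n k).left), AlgebraicGeometry.IsClosedImmersion ι → AlgebraicGeometry.IsIntegral H → (∀ y : (Literature.AlgebraicGeometry.Motives.projectiveSpace n k).left, ∃ U : (Literature.AlgebraicGeometry.Motives.projectiveSpace n k).left.affineOpens, y ∈ (U : (Literature.AlgebraicGeometry.Motives.projectiveSpace n k).left.Opens) ∧ (ι.ker.ideal U).IsPrincipal) → n = 3 → ∃ 𝔞 : H.IdealSheafData, 𝔞 ≠ ⊥ ∧ ∀ (Z : AlgebraicGeometry.Scheme.{0})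 (π : Z ⟶ H), Literature.AlgebraicGeometry.Resolution.IsBlowup π 𝔞 → Literature.AlgebraicGeometry.Resolution.Scheme.IsRegular Z :=
  stub_blowupModel_three_of_sigmaMaxElimination (CossartJannsenSaito2020_sigmaMaxElimination_of_nuElimination h)

end Summit.ResolutionOfSingularities.ResolutionOfSingularities.Cruxes.EquisingularLift.StrataSplit

end
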